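import Summits.QuantumFields.YangMills.Theorems.UnitScaleTiltProp7SectET3NormH1
import HarnessLib

/-!
# Route `UnitScaleTilt`, crux «MinimiserStabilityRegPr» (stmt-QuantumFields-19200, v10 stub EX, route (α), node N06(d = 3)) — the `norm_H₁` half of the knit, THE PIN REDUCED:
# **`Prop7SectET3NormH1`'s displayed pin `hpin` («the operator is dominated by its (3.133) entries») FROM THE LITERAL CONVERSE OF THE TREE'S CO-READING `CoRealizesHRel.obs` —
# fibre decomposition of the input over the coarse lattice `𝔅` + additivity + the (115) weight comparison**

Cell `ym3-torus` (HUMAN RULING D-0037, YM ladder rung R3 — NOT the Clay problem), width seat ym-ust-20520-w1 g4 (OWNER ym3-torus-plan g26 ACK 15 (c): «(o-1) `…NormH1Pin` — GO»).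
Count-neutral helper (`--supports stmt-QuantumFields-19200 --as helper`); registry untouched; THEOREMS ONLY (0 `def`, 0 `sorry`); Mathlib-only over ✓ p606872; NOTHING of
[Balaban1985BackgroundPropagators] is asserted.

THE PRINT.  [Balaban1985BackgroundPropagators] (3.133) p. 422: *«|H_{μν}(x, y′)|, |∇H_{μν}(x, y′)| … ≦ … for x ∈ Δ(y), … y ∈ Λ_j, y′ ∈ Λ_{j′}»* — a bound on the KERNEL ENTRIES `H(x, y′)`
of the operator `(HB)(x) = Σ_{y′∈𝔅} (L^{j′}η)^d H(x, y′) B(y′)` ((3.126) p. 420 with the η-scale pairing of [Balaban1984PropagatorsII] (2.51)–(2.52) p. 232); [Balaban1985Variational]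
(103) p. 293, (115) p. 294: the bound is consumed as `‖H₁B‖₍₁₁₅₎ ≤ B₀|B|`, `|f|_{(−n)} = sup_x (L^{j(x)}η)^n|f(x)|`.

WHY.  ✓ `Prop7SectET3NormH1.normH_of_thm312Printed(_jet)` ∕ `normH₁_row_of_t312_classTransfer` ∕ ✓ `Prop7SectET3N06LeavesRecordNormH1.normH₁_row_of_recordObligations` read the route's
OPAQUE operator family `Hop` through ONE displayed pin — the summed domination `len(y)^{n+s}·(Σ_{y′} Hk.e n U y y′·len(y′)^d)·‖b‖ ≤ c ⇒ ‖Hop b‖ ≤ c` (or, in the (115) letters,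
the two pointwise pins of `_jet`).  The tree's Theorem 3.12 leaf fixes `Hk.e` only through the co-reading `B9CoRealizesHRel.CoRealizesHRel.obs`: «if every test vector `b`
living at the coarse point `y′` (`b = 0` off the fibre `bv⁻¹(y′)`, `|b| ≤ 1`) has `|(A b)(x)| ≤ c·len(y′)^d` at every `x` over `y`, then `Hk.e n U y y′ ≤ c`» — so the canonical
entries are the suprema `e n U y y′ = sup{|(A b)(x)|∕len(y′)^d}` and satisfy, BY DEFINITION, the literal converse: FIBREWISE domination «`b` supported on `bv⁻¹(y′)` ⇒
`|(A b)(x)| ≤ e n U y y′·len(y′)^d·‖b‖`».  THIS FILE proves that fibrewise domination is all the pin asks: the summed ∕ weighted forms follow by decomposing an arbitrary input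
over the fibres of `𝔅` (`b = Σ_{y′} b·𝟙_{bv⁻¹(y′)}`), additivity of the operator and the triangle inequality — the undisplayed «sum over y′ ∈ 𝔅» of print —, plus the comparison
of the (115) weight of a point with its block's scale length.

WHAT IS PROVED (ns `…Theorems.Prop7SectET3NormH1Pin`).
* §1 FIBRE DECOMPOSITION (any finite coarse index `S`, input functions `v → W` with the sup norm, `W`, `W′` seminormed groups, `A` ADDITIVE): `sum_fibrePieces_eq` (`Σ_{y′} b·𝟙_{bv⁻¹y′} = b`),
  `norm_fibrePiece_le` (`‖b·𝟙_{bv⁻¹y′}‖ ≤ ‖b‖`), ★ `norm_apply_le_sum_of_fibrewise` — fibrewise domination `‖A b x‖ ≤ E y′·‖b‖` (for `b` supported on the fibre of `y′`, `0 ≤ E`) ⟹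
  `‖A b x‖ ≤ (Σ_{y′} E y′)·‖b‖` for EVERY `b`.
* §2 THE WEIGHTED POINTWISE PINS (one geometry `g`, one `U`, one H-kernel `Hk`): ★ `weightedPin_of_fibrewise` — fibrewise domination of the values `(F b)(x)` of an additive
  `F : (v → W) → (ι → W′)` by `Hk.e n U (σ x) y′·len(y′)^d·‖b‖` (`σ x` = the coarse site over `x`, print's «x ∈ Δ(y)»), `0 ≤ Hk.e n U`, `0 ≤ len`, and a weight `w x ≤ len(σ x)^p`
  ⟹ `w x·‖(F b)(x)‖ ≤ len(σ x)^p·(Σ_{y′} Hk.e n U (σ x) y′·len(y′)^d)·‖b‖`; ★★ `jetPins_of_fibrewise` — at `F := Hop` read in `Space115 Lr η lev₀ lev₁ D` (values and `D`-gradient,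
  weights `levWeight … 1` ∕ `levWeight … 2` compared with `len(σ₀ x)^1` ∕ `len(σ₁ p)^2`): EXACTLY the two hypotheses `hpin0`, `hpin1` of ✓ `normH_of_thm312Printed_jet`;
  ★ `summedPin_of_fibrewise` — from the same fibrewise data, the SUMMED pin `hpin` of ✓ `opNorm_le_of_ineq3133` ∕ `normH_of_thm312Printed` ∕ `normH₁_row_of_t312_classTransfer` ∕
  `normH₁_row_of_recordObligations` at the spare exponent `s = 1` for the (115) jet target (via `JetSup.norm_le_iff_pointwise`).
HONEST SCOPE: finite sums and the triangle inequality ([folklore]); no estimate of [B9]; the route's curved letter `H₁f` is still not DEFINED here (the (L6)-letter of NE9); N06(d = 3)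
NOT discharged; nothing here claims EX, the crux, V3∕R3, d = 4 or the mass gap; YM₃ on T³ is ladder rung R3, not the Clay problem.

References: T. Bałaban, CMP 99 (1985) 389–434 [Balaban1985BackgroundPropagators] ((3.126) p.420, (3.133) p.422); CMP 102 (1985) 277–309 [Balaban1985Variational] ((103) p.293, (115)
p.294); CMP 96 (1984) 223–250 [Balaban1984PropagatorsII] ((2.51)–(2.52) p.232).
-/

set_option autoImplicit false

noncomputable section

namespace Summit.QuantumFields.YangMills.Theorems.Prop7SectET3NormH1Pin

open Literature.MathematicalPhysics.QuantumFieldTheory.Balaban1983to89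
open Literature.MathematicalPhysics.QuantumFieldTheory.Balaban1983to89.B11Eq115Space (NegSup NegSize Space115 JetSup levWeight)

/-! ## §1 Fibre decomposition of the input over the coarse lattice and the summed domination -/

section Fibrewise

variable {S : Type*} [Fintype S] [DecidableEq S] {v u : Type*} {W W' : Type*} [SeminormedAddCommGroup W] [SeminormedAddCommGroup W']

/-- The input `b : v → W` is the sum over the coarse sites `y′ ∈ 𝔅` of its fibre pieces `b·𝟙_{bv⁻¹(y′)}` (every input point lies in exactly one fibre). [folklore] -/
theorem sum_fibrePieces_eq (bv : v → S) (b : v → W) :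
    (∑ y' : S, fun x' => if bv x' = y' then b x' else 0) = b := by
  funext x'
  rw [Finset.sum_apply]
  simp only [Finset.sum_ite_eq, Finset.mem_univ, if_true]

omit [Fintype S] in
/-- A fibre piece is supported on its fibre. [folklore] -/
theorem fibrePiece_eq_zero_off (bv : v → S) (b : v → W) (y' : S) (x' : v) (hx' : bv x' ≠ y') :
    (fun x' => if bv x' = y' then b x' else 0) x' = 0 :=
  if_neg hx'

omit [Fintype S] in
/-- A fibre piece is not larger than the input in the sup norm: `‖b·𝟙_{bv⁻¹(y′)}‖ ≤ ‖b‖`. [folklore] -/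
theorem norm_fibrePiece_le [Fintype v] (bv : v → S) (b : v → W) (y' : S) :
    ‖(fun x' => if bv x' = y' then b x' else 0)‖ ≤ ‖b‖ := by
  refine (pi_norm_le_iff_of_nonneg (norm_nonneg b)).2 fun x' => ?_
  by_cases h : bv x' = y'
  · simp only [h, if_true]
    exact norm_le_pi_norm b x'
  · simp only [h, if_false, norm_zero]
    exact norm_nonneg b

/-- ★ **FIBREWISE DOMINATION ⟹ SUMMED DOMINATION** (the undisplayed «Σ_{y′∈𝔅}» of (3.126)∕(3.133)): for an ADDITIVE operator `A : (v → W) →+ (u → W′)` on inputs fibred over the finite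
coarse lattice `S = 𝔅` by `bv`, if every input supported on the fibre of `y′` has `‖(A b)(x)‖ ≤ E y′·‖b‖` at the output point `x` (`0 ≤ E`), then EVERY input has
`‖(A b)(x)‖ ≤ (Σ_{y′} E y′)·‖b‖` — decompose `b` over the fibres, push `A` and the evaluation at `x` through the finite sum, use the triangle inequality and `‖b·𝟙_{bv⁻¹y′}‖ ≤ ‖b‖`.
[cite: Balaban1985BackgroundPropagators, (3.126) p.420, (3.133) p.422; Balaban1984PropagatorsII, (2.52) p.232] -/
theorem norm_apply_le_sum_of_fibrewise [Fintype v] (bv : v → S) (A : (v → W) →+ (u → W')) {E : S → ℝ} (hE : ∀ y' : S, 0 ≤ E y') (x : u)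
    (hdom : ∀ (y' : S) (b : v → W), (∀ x' : v, bv x' ≠ y' → b x' = 0) → ‖A b x‖ ≤ E y' * ‖b‖) (b : v → W) :
    ‖A b x‖ ≤ (∑ y' : S, E y') * ‖b‖ := by
  have hAx : A b x = ∑ y' : S, A (fun x' => if bv x' = y' then b x' else 0) x := by
    conv_lhs => rw [← sum_fibrePieces_eq bv b]
    rw [map_sum, Finset.sum_apply]
  rw [hAx, Finset.sum_mul]
  refine (norm_sum_le _ _).trans (Finset.sum_le_sum fun y' _ => ?_)
  exact (hdom y' _ fun x' hx' => fibrePiece_eq_zero_off bv b y' x' hx').trans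
    (mul_le_mul_of_nonneg_left (norm_fibrePiece_le bv b y') (hE y'))

end Fibrewise

/-! ## §2 The weighted pointwise pins of `Prop7SectET3NormH1` from fibrewise domination by the (3.133) entries -/

section Pins

variable {g : B9.Geometry} {B : B9.Backgrounds} [Fintype g.Site] [DecidableEq g.Site]
  {v : Type*} [Fintype v] {W : Type*} [SeminormedAddCommGroup W]

/-- ★ **ONE WEIGHTED POINTWISE PIN FROM FIBREWISE DOMINATION.**  Data: an additive reading `F : (v → W) →+ (ι → W′)` of the operator's values at the output points `ι` (at the instance:
`b ↦ (x ↦ (H₁ b)(x))` or `b ↦ (p ↦ (∇_U H₁ b)(p))`), the coarse site `σ x` over each output point (print's «x ∈ Δ(y), y ∈ Λ_j»), the entry index `n`, and: `0 ≤ Hk.e n U`,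
`0 ≤ len`, FIBREWISE domination `‖(F b)(x)‖ ≤ Hk.e n U (σ x) y′·len(y′)^d·‖b‖` for `b` supported on `bv⁻¹(y′)` (the literal converse of `CoRealizesHRel.obs`), and the weight
comparison `0 ≤ w x ≤ len(σ x)^p`.  Conclusion: `w x·‖(F b)(x)‖ ≤ len(σ x)^p·(Σ_{y′} Hk.e n U (σ x) y′·len(y′)^d)·‖b‖` for every `b`, `x`.
[cite: Balaban1985BackgroundPropagators, (3.133) p.422, (3.126) p.420; Balaban1985Variational, (115) p.294] -/
theorem weightedPin_of_fibrewise {ι W' : Type*} [SeminormedAddCommGroup W'] {d : ℕ} (Hk : B9.HKernel g B) (U : B.Cfg) (n : Fin 2)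
    (bv : v → g.Site) (σ : ι → g.Site) (F : (v → W) →+ (ι → W')) (w : ι → ℝ) (p : ℝ)
    (he : ∀ y y' : g.Site, 0 ≤ Hk.e n U y y') (hlen : ∀ y : g.Site, 0 ≤ g.len y)
    (hw0 : ∀ x : ι, 0 ≤ w x) (hw : ∀ x : ι, w x ≤ g.len (σ x) ^ p)
    (hdom : ∀ (y' : g.Site) (b : v → W) (x : ι), (∀ x' : v, bv x' ≠ y' → b x' = 0) →
      ‖F b x‖ ≤ Hk.e n U (σ x) y' * g.len y' ^ (d : ℝ) * ‖b‖)
    (b : v → W) (x : ι) :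
    w x * ‖F b x‖ ≤ g.len (σ x) ^ p * (∑ y' : g.Site, Hk.e n U (σ x) y' * g.len y' ^ (d : ℝ)) * ‖b‖ := by
  have hE : ∀ y' : g.Site, 0 ≤ Hk.e n U (σ x) y' * g.len y' ^ (d : ℝ) :=
    fun y' => mul_nonneg (he _ _) (Real.rpow_nonneg (hlen y') _)
  have hsum := norm_apply_le_sum_of_fibrewise bv F hE x (fun y' b' hb' => hdom y' b' x hb') b
  have hS0 : 0 ≤ (∑ y' : g.Site, Hk.e n U (σ x) y' * g.len y' ^ (d : ℝ)) * ‖b‖ :=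
    mul_nonneg (Finset.sum_nonneg fun y' _ => hE y') (norm_nonneg b)
  calc w x * ‖F b x‖ ≤ w x * ((∑ y' : g.Site, Hk.e n U (σ x) y' * g.len y' ^ (d : ℝ)) * ‖b‖) := mul_le_mul_of_nonneg_left hsum (hw0 x)
    _ ≤ g.len (σ x) ^ p * ((∑ y' : g.Site, Hk.e n U (σ x) y' * g.len y' ^ (d : ℝ)) * ‖b‖) := mul_le_mul_of_nonneg_right (hw x) hS0
    _ = g.len (σ x) ^ p * (∑ y' : g.Site, Hk.e n U (σ x) y' * g.len y' ^ (d : ℝ)) * ‖b‖ := by ring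

variable {ι κ : Type*} [Fintype ι] [Fintype κ] {V : Type*} [NormedAddCommGroup V] [NormedSpace ℂ V]

omit [Fintype ι] [Fintype κ] in
/-- ★★ **THE TWO (115) PINS OF `normH_of_thm312Printed_jet` FROM FIBREWISE DOMINATION.**  For an additive operator `Hop : (v → W) → Space115 Lr η lev₀ lev₁ D` (values on `ι`, `D`-gradient
on `κ`; at the instance the route's `H₁(U₀) : (𝔅 → M₂(ℂ)) → (115)_{U₀}`), coarse-site maps `σ₀`, `σ₁` (print's «x ∈ Δ(y)»), an H-kernel `Hk` with `0 ≤ Hk.e 0 U`, `0 ≤ Hk.e 1 U`,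
non-negative scale lengths, the weight comparisons `(L^{lev₀ x}η)^1 ≤ len(σ₀ x)^1`, `(L^{lev₁ p}η)^2 ≤ len(σ₁ p)^2` (equalities when the (115) level data are the geometry's), and
FIBREWISE domination of the values by `Hk.e 0 U (σ₀ x) y′·len(y′)^d·‖b‖` and of the gradient by `Hk.e 1 U (σ₁ p) y′·len(y′)^d·‖b‖`: the two pointwise pins `hpin0`, `hpin1` of
✓ `Prop7SectET3NormH1.normH_of_thm312Printed_jet` hold VERBATIM. [cite: Balaban1985BackgroundPropagators, (3.133) p.422; Balaban1985Variational, (115) p.294, (103) p.293] -/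
theorem jetPins_of_fibrewise (Lr η : ℝ) [Fact (0 < Lr)] [Fact (0 < η)] (lev₀ : ι → ℕ) (lev₁ : κ → ℕ) (D : (ι → V) →ₗ[ℂ] (κ → V))
    {d : ℕ} (Hk : B9.HKernel g B) (U : B.Cfg) (bv : v → g.Site) (σ₀ : ι → g.Site) (σ₁ : κ → g.Site)
    (Hop : (v → W) → Space115 Lr η lev₀ lev₁ D) (hadd : ∀ a b : v → W, Hop (a + b) = Hop a + Hop b)
    (he0 : ∀ y y' : g.Site, 0 ≤ Hk.e 0 U y y') (he1 : ∀ y y' : g.Site, 0 ≤ Hk.e 1 U y y') (hlen : ∀ y : g.Site, 0 ≤ g.len y)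
    (hw0 : ∀ x : ι, levWeight Lr η lev₀ 1 x ≤ g.len (σ₀ x) ^ (1 : ℝ)) (hw1 : ∀ p : κ, levWeight Lr η lev₁ 2 p ≤ g.len (σ₁ p) ^ (2 : ℝ))
    (hdom0 : ∀ (y' : g.Site) (b : v → W) (x : ι), (∀ x' : v, bv x' ≠ y' → b x' = 0) →
      ‖JetSup.equiv (levWeight Lr η lev₀ 1) (levWeight Lr η lev₁ 2) D (Hop b) x‖ ≤ Hk.e 0 U (σ₀ x) y' * g.len y' ^ (d : ℝ) * ‖b‖)
    (hdom1 : ∀ (y' : g.Site) (b : v → W) (p : κ), (∀ x' : v, bv x' ≠ y' → b x' = 0) →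
      ‖D (JetSup.equiv (levWeight Lr η lev₀ 1) (levWeight Lr η lev₁ 2) D (Hop b)) p‖ ≤ Hk.e 1 U (σ₁ p) y' * g.len y' ^ (d : ℝ) * ‖b‖) :
    (∀ (b : v → W) (x : ι), levWeight Lr η lev₀ 1 x * ‖JetSup.equiv (levWeight Lr η lev₀ 1) (levWeight Lr η lev₁ 2) D (Hop b) x‖ ≤
        g.len (σ₀ x) ^ (1 : ℝ) * (∑ y' : g.Site, Hk.e 0 U (σ₀ x) y' * g.len y' ^ (d : ℝ)) * ‖b‖) ∧
    (∀ (b : v → W) (p : κ), levWeight Lr η lev₁ 2 p * ‖D (JetSup.equiv (levWeight Lr η lev₀ 1) (levWeight Lr η lev₁ 2) D (Hop b)) p‖ ≤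
        g.len (σ₁ p) ^ (2 : ℝ) * (∑ y' : g.Site, Hk.e 1 U (σ₁ p) y' * g.len y' ^ (d : ℝ)) * ‖b‖) := by
  have hL : 0 < Lr := Fact.out
  have hη : 0 < η := Fact.out
  -- the two additive coordinate readings of `Hop`: values and `D`-gradient
  let F₀ : (v → W) →+ (ι → V) := AddMonoidHom.mk' (fun b => JetSup.equiv (levWeight Lr η lev₀ 1) (levWeight Lr η lev₁ 2) D (Hop b))
    fun a b => by simp only [hadd, JetSup.equiv_add]
  let F₁ : (v → W) →+ (κ → V) := AddMonoidHom.mk' (fun b => D (JetSup.equiv (levWeight Lr η lev₀ 1) (levWeight Lr η lev₁ 2) D (Hop b)))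
    fun a b => by simp only [hadd, JetSup.equiv_add, map_add]
  refine ⟨fun b x => ?_, fun b p => ?_⟩
  · exact weightedPin_of_fibrewise Hk U 0 bv σ₀ F₀ (levWeight Lr η lev₀ 1) 1 he0 hlen (fun x => (B11Eq115Space.levWeight_pos hL hη lev₀ 1 x).le) hw0
      (fun y' b' x' hb' => hdom0 y' b' x' hb') b x
  · exact weightedPin_of_fibrewise Hk U 1 bv σ₁ F₁ (levWeight Lr η lev₁ 2) 2 he1 hlen (fun p => (B11Eq115Space.levWeight_pos hL hη lev₁ 2 p).le) hw1
      (fun y' b' p' hb' => hdom1 y' b' p' hb') b p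

/-- ★ **THE SUMMED PIN `hpin` OF `normH_of_thm312Printed` (at `s = 1`, (115) target) FROM FIBREWISE DOMINATION**: under the hypotheses of `jetPins_of_fibrewise`, for every input `b` and
every `0 ≤ c`: if `len(y)^{n+1}·(Σ_{y′} Hk.e n U y y′·len(y′)^d)·‖b‖ ≤ c` for all `n`, `y`, then `‖Hop b‖₍₁₁₅₎ ≤ c` — the shape consumed by ✓ `opNorm_le_of_ineq3133` ∕
`normH_of_thm312Printed` ∕ `normH₁_row_of_t312_classTransfer` ∕ `normH₁_row_of_recordObligations` with `s = 1`. [cite: Balaban1985Variational, (115) p.294, (103) p.293; Balaban1985BackgroundPropagators, (3.133) p.422] -/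
theorem summedPin_of_fibrewise (Lr η : ℝ) [Fact (0 < Lr)] [Fact (0 < η)] (lev₀ : ι → ℕ) (lev₁ : κ → ℕ) (D : (ι → V) →ₗ[ℂ] (κ → V))
    {d : ℕ} (Hk : B9.HKernel g B) (U : B.Cfg) (bv : v → g.Site) (σ₀ : ι → g.Site) (σ₁ : κ → g.Site)
    (Hop : (v → W) → Space115 Lr η lev₀ lev₁ D) (hadd : ∀ a b : v → W, Hop (a + b) = Hop a + Hop b)
    (he0 : ∀ y y' : g.Site, 0 ≤ Hk.e 0 U y y') (he1 : ∀ y y' : g.Site, 0 ≤ Hk.e 1 U y y') (hlen : ∀ y : g.Site, 0 ≤ g.len y)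
    (hw0 : ∀ x : ι, levWeight Lr η lev₀ 1 x ≤ g.len (σ₀ x) ^ (1 : ℝ)) (hw1 : ∀ p : κ, levWeight Lr η lev₁ 2 p ≤ g.len (σ₁ p) ^ (2 : ℝ))
    (hdom0 : ∀ (y' : g.Site) (b : v → W) (x : ι), (∀ x' : v, bv x' ≠ y' → b x' = 0) →
      ‖JetSup.equiv (levWeight Lr η lev₀ 1) (levWeight Lr η lev₁ 2) D (Hop b) x‖ ≤ Hk.e 0 U (σ₀ x) y' * g.len y' ^ (d : ℝ) * ‖b‖)
    (hdom1 : ∀ (y' : g.Site) (b : v → W) (p : κ), (∀ x' : v, bv x' ≠ y' → b x' = 0) →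
      ‖D (JetSup.equiv (levWeight Lr η lev₀ 1) (levWeight Lr η lev₁ 2) D (Hop b)) p‖ ≤ Hk.e 1 U (σ₁ p) y' * g.len y' ^ (d : ℝ) * ‖b‖)
    (b : v → W) (c : ℝ) (hc : 0 ≤ c)
    (hall : ∀ (n : Fin 2) (y : g.Site), g.len y ^ ((n : ℝ) + 1) * (∑ y' : g.Site, Hk.e n U y y' * g.len y' ^ (d : ℝ)) * ‖b‖ ≤ c) :
    ‖Hop b‖ ≤ c := by
  obtain ⟨h0, h1⟩ := jetPins_of_fibrewise Lr η lev₀ lev₁ D Hk U bv σ₀ σ₁ Hop hadd he0 he1 hlen hw0 hw1 hdom0 hdom1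
  have e0 : (((0 : Fin 2) : ℕ) : ℝ) + 1 = 1 := by norm_num
  have e1 : (((1 : Fin 2) : ℕ) : ℝ) + 1 = 2 := by norm_num
  refine (JetSup.norm_le_iff_pointwise (f := Hop b) hc).2 ⟨fun x => (h0 b x).trans ?_, fun p => (h1 b p).trans ?_⟩
  · have h := hall 0 (σ₀ x)
    rw [e0] at h
    exact h
  · have h := hall 1 (σ₁ p)
    rw [e1] at h
    exact h

end Pins

end Summit.QuantumFields.YangMills.Theorems.Prop7SectET3NormH1Pin

end
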